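import Summits.QuantumFields.YangMills.Theorems.LangevinControlUVOSLegsAtWeakCouplingCDefs
import Summits.QuantumFields.YangMills.Theorems.OSLegsAtWeakCouplingC.Negative.GermAtInfinity
import HarnessLib

/-!
# Crux `OSLegsAtWeakCouplingC` (stmt-QuantumFields-16207): the predecessor crux implies it (9367 ⇒ 16207)

Support file (lead c3 of line `Sketch`; the statement and its proof are the standing disprover's positive
by-product, `Cruxes/OSLegsAtWeakCouplingC/Disproof.lean` §5b `crux9367_imp_cruxC`, attached to the item as evidence
`Implication9367to16207SelfContained.lean` and landed here against the TREE's vocabulary: the Defs predicates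
`DlrCollarTransfer.TwoPoint / Skewness / GapInUnits / Concl` (stmt-9367) and `Sketch.ConclC` (stmt-16207), and the
landed negative-side lemma `Negative.conclC_of_concl_tailLift` (…/Negative/GermAtInfinity, p123162)).

`OSLegsFromFemtoAndGap → OSLegsAtWeakCouplingC`: the planner's "both older items imply it" is glue plus ONE use of
`Continuous a`.  Given `(G, r)` and a continuous unit map `a` with H1–H3, transport H1–H3 to the TAIL LIFT
`ã β = a (max β 0) + max (0 − β) 0` (equal to `a` on `[0, ∞)`, `≥ a 0 > 0` below; the hypotheses never see the unit
map below a threshold: `twoPoint_congr_above`, `skewness_congr_above`, `gapInUnits_congr_above`), apply the old crux at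
`ã` to get stmt-9367's conclusion `Concl G r ã`, and come back with `conclC_of_concl_tailLift`: continuity forces every
scheme in units `ã` to run to `β = +∞` (the new conjunct `HasWeakCouplingLimit`), after which the scheme is shifted past
the threshold into units `a`.  So 16207 ⟸ 9367; nothing here bears on the two open imports of line `Sketch`.

Refs: Disproof.lean §5/§5b (refuter-cdisprove-stmt-QuantumFields-16207-0); JaffeWitten2000 §6; MontvayMunster1994 (3.263).
-/

set_option autoImplicit false

noncomputable section

open MeasureTheory Filter Topology
open Literature.MathematicalPhysics.QuantumFieldTheory Literature.MathematicalPhysics.QuantumLattice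
open Literature.MathematicalPhysics.AQFT
open Summit.QuantumFields.YangMills.Theses.LangevinControlUV (OSLegsAtWeakCouplingC OSLegsFromFemtoAndGap)
open Summit.QuantumFields.YangMills.Cruxes.OSLegsFromFemtoAndGap.DlrCollarTransfer
  (TwoPoint Skewness GapInUnits Concl crux_iff)
open Summit.QuantumFields.YangMills.Cruxes.OSLegsAtWeakCouplingC.Sketch (ConclC cruxC_iff)
open Summit.QuantumFields.YangMills.Theorems.OSLegsAtWeakCouplingC.Negative (conclC_of_concl_tailLift)

namespace Summit.QuantumFields.YangMills.Theorems.OSLegsAtWeakCouplingC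

variable {G : Type} [Group G] [TopologicalSpace G] [IsTopologicalGroup G] [CompactSpace G]
  [MeasurableSpace G] [BorelSpace G]

/-! ## The hypotheses never see the unit map below a threshold -/

/-- **H1 is a tail property of the unit map**: any POSITIVE `a'` agreeing with `a` on `[βs, ∞)` inherits the femto
two-point package (same `Γ, ℓ₀, c, C`; threshold `max β₀ βs`; the limit clause is eventual).  (Disproof of stmt-9367,
§6 `twoPoint_congr_above`, restated over the Defs predicate.) -/
theorem twoPoint_congr_above (r : LatticeRep G) {a a' : ℝ → ℝ} (βs : ℝ) (hpos : ∀ β, 0 < a' β)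
    (heq : ∀ β, βs ≤ β → a' β = a β) (h : TwoPoint G r a) : TwoPoint G r a' := by
  obtain ⟨Γ, β₀, ℓ₀, c, C, hℓ, hc, -, hlim, hΓ, H⟩ := h
  refine ⟨Γ, max β₀ βs, ℓ₀, c, C, hℓ, hc, hpos, ?_, hΓ, ?_⟩
  · exact hlim.congr' (by
      filter_upwards [eventually_ge_atTop βs] with β hβ using (heq β hβ).symm)
  · intro L _ β hβ hL
    rw [heq β (le_of_max_le_right hβ)] at hL ⊢
    exact H L β (le_of_max_le_left hβ) hL

/-- **H2 is a tail property of the unit map** (threshold `max β₁ βs`). -/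
theorem skewness_congr_above (r : LatticeRep G) {a a' : ℝ → ℝ} (βs : ℝ)
    (heq : ∀ β, βs ≤ β → a' β = a β) (h : Skewness G r a) : Skewness G r a' := by
  obtain ⟨Γ₃, β₁, ℓ₁, c₃, hℓ, hc, hΓ, H⟩ := h
  refine ⟨Γ₃, max β₁ βs, ℓ₁, c₃, hℓ, hc, hΓ, ?_⟩
  intro L _ β hβ hL
  rw [heq β (le_of_max_le_right hβ)] at hL ⊢
  exact H L β (le_of_max_le_left hβ) hL

/-- **H3 is a tail property of the unit map** (same rate `c₁`, same `S₁`, threshold `max β₂ βs`). -/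
theorem gapInUnits_congr_above (r : LatticeRep G) {a a' : ℝ → ℝ} (βs : ℝ)
    (heq : ∀ β, βs ≤ β → a' β = a β) (h : GapInUnits G r a) : GapInUnits G r a' := by
  obtain ⟨c₁, β₂, S₁, hc, H⟩ := h
  refine ⟨c₁, max β₂ βs, S₁, hc, fun A B => ?_⟩
  obtain ⟨C, hC⟩ := H A B
  refine ⟨C, fun β hβ S n hS hn => ?_⟩
  rw [heq β (le_of_max_le_right hβ)]
  exact hC β (le_of_max_le_left hβ) S n hS hn

/-! ## 9367 ⇒ 16207 -/

/-- **9367 ⇒ 16207, pointwise in `(G, r)`.**  If stmt-9367's implication `H1 → H2 → H3 → Concl` holds at `(G, r)`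
for EVERY unit map, then stmt-16207's implication `H1 → H2 → H3 → ConclC` holds at `(G, r)` for every CONTINUOUS
unit map: transport H1–H3 to the tail lift `β ↦ a (max β 0) + max (0 − β) 0`, apply the old implication there,
and return by `Negative.conclC_of_concl_tailLift` (the one place continuity is used). -/
theorem conclC_of_concl_forall_units (r : LatticeRep G) {a : ℝ → ℝ} (ha : Continuous a)
    (h9367 : ∀ a' : ℝ → ℝ, TwoPoint G r a' → Skewness G r a' → GapInUnits G r a' → Concl G r a')
    (h1 : TwoPoint G r a) (h2 : Skewness G r a) (h3 : GapInUnits G r a) : ConclC G r a := by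
  have h1' := h1
  obtain ⟨-, -, -, -, -, -, -, hpos, -, -⟩ := h1'
  -- the tail lift at threshold `0`
  have hpos' : ∀ β, 0 < a (max β 0) + max (0 - β) 0 := fun β =>
    add_pos_of_pos_of_nonneg (hpos _) (le_max_right _ _)
  have heq : ∀ β, (0 : ℝ) ≤ β → a (max β 0) + max (0 - β) 0 = a β := fun β hβ => by
    rw [max_eq_left hβ, max_eq_right (by linarith), add_zero]
  have hC : Concl G r (fun β => a (max β 0) + max (0 - β) 0) :=
    h9367 _ (twoPoint_congr_above r 0 hpos' heq h1) (skewness_congr_above r 0 heq h2)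
      (gapInUnits_congr_above r 0 heq h3)
  exact conclC_of_concl_tailLift r ha hpos 0 hC

/-- **`OSLegsFromFemtoAndGap → OSLegsAtWeakCouplingC`** (stmt-9367 implies stmt-16207; kernel-checked form of the
planner's "both older items imply it": glue plus one use of `Continuous a`).  Conditional by nature — the antecedent
is the open predecessor crux; recorded so that a proof of either typing of the OS legs closes this item. -/
theorem osLegsAtWeakCouplingC_of_osLegsFromFemtoAndGap (h : OSLegsFromFemtoAndGap) : OSLegsAtWeakCouplingC := by
  rw [cruxC_iff]
  intro G _ _ _ _ hG
  letI : MeasurableSpace G := borel G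
  haveI : BorelSpace G := ⟨rfl⟩
  intro r a ha h1 h2 h3
  exact conclC_of_concl_forall_units r ha (fun a' => (crux_iff.1 h) G hG r a') h1 h2 h3

end Summit.QuantumFields.YangMills.Theorems.OSLegsAtWeakCouplingC

end
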